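import Literature.Probability.RandomPlanarGeometry.SAWTriangularBridgeInsertion
import HarnessLib

/-!
# Half-space walks of the triangular lattice: `h_n · b_M ≤ (n+1) · h_{n+M}` and `h_{n+M} ≤ h_n · c_M`

Topic `Literature/Probability/RandomPlanarGeometry` (continues `SAWTriangularBridgeInsertion.lean`: the bridge insertion
at the last maximum, `TriBridgeInsertion.insertBridge`, `insertBridge_mem_brickSaws`, `insertBridge_injective`,
`lastMaxClass`; and `SAWTriangularBridges.lean`: `brickHalfSpaceWalks`, `brickHalfSpaceCount = h_n(𝕋)`, `Zd.IsHalfSpace`).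

Source: N. Madras, G. Slade, *The Self-Avoiding Walk* (1993), Definition 3.1.2 (half-space walks), §1.2 eq. (1.2.3)
(submultiplicativity by cutting a walk), eq. (1.2.15) (concatenation with a bridge), §8.1 proof of Proposition 8.1.2
(reflection after the maximum) and §7.5 eqs. (7.5.1)–(7.5.2) (the role of insertion inequalities with polynomial loss
in Kesten's `N^{-1/3}` rates).  Two elementary inequalities for the half-space walks of `𝕋` (brick height = coordinate
`0`), the super- and sub-multiplicativity inputs of the `N^{-1/3}` rate for `h_{N+1}(𝕋)/h_N(𝕋)`:

* **`brickHalfSpaceCount_mul_brickBridgeCount_le : h_n · b_M ≤ (n+1) · h_{n+M}`** — the bridge insertion at the last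
  maximum of `SAWTriangularBridgeInsertion.lean` keeps a half-space walk a half-space walk (every height after time `0`
  stays positive: the prefix is untouched, the bridge sits above the maximum `D ≥ 0`, the reflected tail above the
  bridge);
* **`brickHalfSpaceCount_add_le : h_{n+M} ≤ h_n · c_M(𝕋)`** — cut at time `n`: the prefix is a half-space walk, the
  suffix an arbitrary self-avoiding walk.

Neither is located in print as stated (the `ℤ^d` analogue of the first is the tree's `Zd.count_mul_bridgeCount_le`
device; the second is the half-space case of (1.2.3)).
-/

noncomputable section

open Finset Function Literature.Probability.LatticeModels Literature.Probability.Percolation SimpleGraph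
open scoped BigOperators

namespace Literature.Probability.RandomPlanarGeometry.SAW

open TriBridgeInsertion

namespace TriHalfSpaceInsertion

variable {j M n : ℕ} {ω β : ℕ → Site 2}

/-- Values of the insertion map up to time `j`. [cite: MadrasSlade1993, §8.1 (proof of Proposition 8.1.2)] -/
private theorem ins_of_le {i : ℕ} (h : i ≤ j) : insertBridge j M ω β i = ω i := by
  simp [insertBridge, h]

/-- Values of the insertion map inside the bridge. [cite: MadrasSlade1993, §8.1 (proof of Proposition 8.1.2)] -/
private theorem ins_mid {i : ℕ} (h1 : j < i) (h2 : i ≤ j + M) : insertBridge j M ω β i = ω j + β (i - j) := by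
  simp [insertBridge, show ¬ i ≤ j by omega, h2]

/-- Heights of the insertion map after the bridge. [cite: MadrasSlade1993, §8.1 (proof of Proposition 8.1.2)] -/
private theorem ins_of_gt_apply_zero {i : ℕ} (h : j + M < i) :
    insertBridge j M ω β i 0 = (ω j 0 + β M 0 + (ω j 0 - ω (j + 1) 0)) + ω (j + 1) 0 - ω (i - M) 0 := by
  simp only [insertBridge, show ¬ i ≤ j by omega, show ¬ i ≤ j + M by omega, if_false, sigmaMap, Pi.add_apply,
    Pi.sub_apply, Zd.reflCoord_apply_zero]
  ring

/-- **The inserted walk is a half-space walk** when `ω` is: its heights after time `0` are those of `ω[1..j]` (positive),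
of the bridge above the maximum `D ≥ 0`, and of the reflected tail above the bridge.
[cite: MadrasSlade1993, Definition 3.1.2 and §8.1 (proof of Proposition 8.1.2)] -/
theorem insertBridge_mem_brickHalfSpaceWalks (hω : ω ∈ brickHalfSpaceWalks n) (hβ : β ∈ brickBridges M) (hj : j ≤ n)
    (hmax : ∀ i ≤ n, ω i 0 ≤ ω j 0) (hlt : ∀ i, j < i → i ≤ n → ω i 0 < ω j 0) :
    insertBridge j M ω β ∈ brickHalfSpaceWalks (n + M) := by
  obtain ⟨hωs, hωh⟩ := mem_brickHalfSpaceWalks.1 hω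
  obtain ⟨h0, -, -, -⟩ := mem_brickSaws.1 hωs
  obtain ⟨hβs, hβb⟩ := mem_brickBridges.1 hβ
  obtain ⟨hβ0, -, -, -⟩ := mem_brickSaws.1 hβs
  have h00 : ω 0 0 = 0 := by rw [h0]; rfl
  have hβ00 : β 0 0 = 0 := by rw [hβ0]; rfl
  have hD0 : 0 ≤ ω j 0 := by have := hmax 0 (Nat.zero_le _); rwa [h00] at this
  have hβpos : ∀ t, 1 ≤ t → t ≤ M → 0 < β t 0 := fun t h1 h2 => hβ00 ▸ (hβb t h1 h2).1
  have hβM0 : 0 ≤ β M 0 := by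
    rcases Nat.eq_zero_or_pos M with hM | hM
    · rw [hM, hβ00]
    · exact (hβpos M hM le_rfl).le
  refine mem_brickHalfSpaceWalks.2 ⟨insertBridge_mem_brickSaws hωs hβ hj hmax hlt, fun i hi1 hi2 => ?_⟩
  rw [ins_of_le (Nat.zero_le _), h00]
  rcases le_or_gt i j with h1 | h1
  · rw [ins_of_le h1, ← h00]
    exact hωh i hi1 (by omega)
  rcases le_or_gt i (j + M) with h2 | h2
  · rw [ins_mid h1 h2, Pi.add_apply]
    have := hβpos (i - j) (by omega) (by omega)
    linarith
  · rw [ins_of_gt_apply_zero h2]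
    have := hlt (i - M) (by omega) (by omega)
    linarith

open Classical in
/-- The half-space walks of `lastMaxClass n j` (last maximum of the height at time `j`).
[cite: MadrasSlade1993, §3.1 (proof of Proposition 3.1.5) and Definition 3.1.2] -/
def hsLastMaxClass (n j : ℕ) : Finset (ℕ → Site 2) :=
  (lastMaxClass n j).filter fun ω => ω ∈ brickHalfSpaceWalks n

/-- Membership in `hsLastMaxClass`. [cite: MadrasSlade1993, Definition 3.1.2] -/
theorem mem_hsLastMaxClass {n j : ℕ} {ω : ℕ → Site 2} :
    ω ∈ hsLastMaxClass n j ↔ ω ∈ lastMaxClass n j ∧ ω ∈ brickHalfSpaceWalks n := by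
  classical
  exact Finset.mem_filter

open Classical in
/-- Every half-space walk lies in the half-space part of the class of its last maximum.
[cite: MadrasSlade1993, §3.1 (proof of Proposition 3.1.5)] -/
theorem brickHalfSpaceWalks_subset_biUnion (n : ℕ) :
    brickHalfSpaceWalks n ⊆ (Finset.range (n + 1)).biUnion (hsLastMaxClass n) := by
  classical
  intro ω hω
  have hωs : ω ∈ brickSaws n := (mem_brickHalfSpaceWalks.1 hω).1
  have h := brickSaws_subset_biUnion_lastMaxClass n hωs
  rw [Finset.mem_biUnion] at h ⊢
  obtain ⟨j, hj, hjc⟩ := h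
  exact ⟨j, hj, mem_hsLastMaxClass.2 ⟨hjc, hω⟩⟩

/-- Class × bridges injects into the `(n+M)`-step half-space walks: `#(hsLastMaxClass n j) · b_M ≤ h_{n+M}` for `j ≤ n`.
[cite: MadrasSlade1993, §1.2 eq. (1.2.15) and §8.1 (proof of Proposition 8.1.2)] -/
theorem card_hsLastMaxClass_mul_brickBridgeCount_le {n j : ℕ} (hj : j ≤ n) (M : ℕ) :
    #(hsLastMaxClass n j) * brickBridgeCount M ≤ brickHalfSpaceCount (n + M) := by
  classical
  rw [brickBridgeCount, ← Finset.card_product, brickHalfSpaceCount]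
  refine Finset.card_le_card_of_injOn (fun p => insertBridge j M p.1 p.2) ?_ ?_
  · rintro ⟨ω, β⟩ hp
    simp only [Finset.mem_coe, Finset.mem_product, mem_hsLastMaxClass, mem_lastMaxClass] at hp
    obtain ⟨⟨⟨-, hmax, hlt⟩, hω⟩, hβ⟩ := hp
    show insertBridge j M ω β ∈ (brickHalfSpaceWalks (n + M) : Set (ℕ → Site 2))
    rw [Finset.mem_coe]
    exact insertBridge_mem_brickHalfSpaceWalks hω hβ hj hmax hlt
  · rintro ⟨ω, β⟩ hp ⟨ω', β'⟩ hp' h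
    simp only [Finset.mem_coe, Finset.mem_product, mem_hsLastMaxClass, mem_brickBridges] at hp hp'
    obtain ⟨hωω, hββ⟩ := insertBridge_injective hp.2.1 hp'.2.1 h
    exact Prod.ext hωω hββ

end TriHalfSpaceInsertion

open TriHalfSpaceInsertion

/-! ### The insertion inequality for half-space walks -/

/-- **`h_n(𝕋) · b_M(𝕋) ≤ (n+1) · h_{n+M}(𝕋)`**: inserting a bridge at the last maximum of a half-space walk gives a
half-space walk, injectively once the time of the maximum is known.
[cite: MadrasSlade1993, §1.2 eq. (1.2.15), §8.1 (proof of Proposition 8.1.2) and §7.5 eqs. (7.5.1)–(7.5.2)] -/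
theorem brickHalfSpaceCount_mul_brickBridgeCount_le (n M : ℕ) :
    brickHalfSpaceCount n * brickBridgeCount M ≤ (n + 1) * brickHalfSpaceCount (n + M) := by
  classical
  have h1 : #(brickHalfSpaceWalks n) ≤ ∑ j ∈ Finset.range (n + 1), #(hsLastMaxClass n j) :=
    (Finset.card_le_card (brickHalfSpaceWalks_subset_biUnion n)).trans
      (Finset.card_biUnion_le (s := Finset.range (n + 1)) (t := hsLastMaxClass n))
  rw [← brickHalfSpaceCount] at h1
  calc brickHalfSpaceCount n * brickBridgeCount M
      ≤ (∑ j ∈ Finset.range (n + 1), #(hsLastMaxClass n j)) * brickBridgeCount M := Nat.mul_le_mul_right _ h1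
    _ = ∑ j ∈ Finset.range (n + 1), #(hsLastMaxClass n j) * brickBridgeCount M := Finset.sum_mul _ _ _
    _ ≤ ∑ j ∈ Finset.range (n + 1), brickHalfSpaceCount (n + M) :=
      Finset.sum_le_sum fun j hj =>
        card_hsLastMaxClass_mul_brickBridgeCount_le (Nat.le_of_lt_succ (Finset.mem_range.1 hj)) M
    _ = (n + 1) * brickHalfSpaceCount (n + M) := by rw [Finset.sum_const, Finset.card_range, smul_eq_mul]

/-! ### Cutting a half-space walk: `h_{n+M} ≤ h_n · c_M` -/

namespace TriHalfSpaceInsertion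

/-- The prefix `ω[0..n]` (frozen after `n`). [cite: MadrasSlade1993, §1.2 eq. (1.2.3)] -/
def prefixWalk (n : ℕ) (ω : ℕ → Site 2) : ℕ → Site 2 := fun i => ω (min i n)

/-- The suffix `ω[n..n+M]` re-based at `0` (frozen after `M`). [cite: MadrasSlade1993, §1.2 eq. (1.2.3)] -/
def suffixWalk (n M : ℕ) (ω : ℕ → Site 2) : ℕ → Site 2 := fun i => ω (n + min i M) - ω n

/-- The prefix of a half-space walk is a half-space walk. [cite: MadrasSlade1993, §1.2 eq. (1.2.3), Definition 3.1.2] -/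
theorem prefixWalk_mem {n M : ℕ} {ω : ℕ → Site 2} (hω : ω ∈ brickHalfSpaceWalks (n + M)) :
    prefixWalk n ω ∈ brickHalfSpaceWalks n := by
  obtain ⟨hωs, hωh⟩ := mem_brickHalfSpaceWalks.1 hω
  obtain ⟨h0, -, hadj, hinj⟩ := mem_brickSaws.1 hωs
  refine mem_brickHalfSpaceWalks.2 ⟨mem_brickSaws.2 ⟨?_, fun i hi => ?_, fun i hi => ?_, ?_⟩, fun i hi1 hi2 => ?_⟩
  · simp [prefixWalk, h0]
  · simp [prefixWalk, min_eq_right hi]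
  · simp only [prefixWalk, min_eq_left hi.le, min_eq_left (Nat.succ_le_of_lt hi)]
    exact hadj i (by omega)
  · intro a ha b hb hab
    simp only [Set.mem_setOf_eq] at ha hb
    simp only [prefixWalk, min_eq_left ha, min_eq_left hb] at hab
    exact hinj (show a ≤ n + M by omega) (show b ≤ n + M by omega) hab
  · simp only [prefixWalk, Nat.zero_min, min_eq_left hi2]
    exact hωh i hi1 (by omega)

/-- The re-based suffix of a self-avoiding walk is a self-avoiding walk. [cite: MadrasSlade1993, §1.2 eq. (1.2.3)] -/
theorem suffixWalk_mem {n M : ℕ} {ω : ℕ → Site 2} (hω : ω ∈ brickSaws (n + M)) :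
    suffixWalk n M ω ∈ brickSaws M := by
  obtain ⟨-, hend, hadj, hinj⟩ := mem_brickSaws.1 hω
  refine mem_brickSaws.2 ⟨?_, fun i hi => ?_, fun i hi => ?_, ?_⟩
  · simp [suffixWalk]
  · simp [suffixWalk, min_eq_right hi]
  · simp only [suffixWalk, min_eq_left hi.le, min_eq_left (Nat.succ_le_of_lt hi), brickGraph_adj_sub_right,
      show n + (i + 1) = n + i + 1 by omega]
    exact hadj (n + i) (by omega)
  · intro a ha b hb hab
    simp only [Set.mem_setOf_eq] at ha hb
    simp only [suffixWalk, min_eq_left ha, min_eq_left hb, sub_left_inj] at hab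
    have := hinj (show n + a ≤ n + M by omega) (show n + b ≤ n + M by omega) hab
    omega

/-- The cut `ω ↦ (prefix, suffix)` is injective on `(n+M)`-step walks. [cite: MadrasSlade1993, §1.2 eq. (1.2.3)] -/
theorem cut_injOn (n M : ℕ) :
    Set.InjOn (fun ω => (prefixWalk n ω, suffixWalk n M ω)) ↑(brickHalfSpaceWalks (n + M)) := by
  intro ω hω ω' hω' h
  rw [Finset.mem_coe] at hω hω'
  obtain ⟨-, hend, -, -⟩ := mem_brickSaws.1 (mem_brickHalfSpaceWalks.1 hω).1
  obtain ⟨-, hend', -, -⟩ := mem_brickSaws.1 (mem_brickHalfSpaceWalks.1 hω').1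
  simp only [Prod.mk.injEq] at h
  obtain ⟨hp, hs⟩ := h
  have hpre : ∀ i ≤ n, ω i = ω' i := fun i hi => by
    have := congrFun hp i
    simpa [prefixWalk, min_eq_left hi] using this
  have hn := hpre n le_rfl
  funext i
  rcases le_or_gt i n with hi | hi
  · exact hpre i hi
  rcases le_or_gt i (n + M) with hi2 | hi2
  · have := congrFun hs (i - n)
    simp only [suffixWalk, min_eq_left (show i - n ≤ M by omega), show n + (i - n) = i by omega, hn] at this
    exact sub_left_injective this
  · rw [hend i hi2.le, hend' i hi2.le]
    have := congrFun hs M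
    simp only [suffixWalk, min_self, hn] at this
    exact sub_left_injective this

end TriHalfSpaceInsertion

/-- **`h_{n+M}(𝕋) ≤ h_n(𝕋) · c_M(𝕋)`**: cut an `(n+M)`-step half-space walk at time `n` — the prefix is an `n`-step
half-space walk, the re-based suffix an `M`-step self-avoiding walk, and the pair determines the walk.
[cite: MadrasSlade1993, §1.2 eq. (1.2.3) and Definition 3.1.2] -/
theorem brickHalfSpaceCount_add_le (n M : ℕ) :
    brickHalfSpaceCount (n + M) ≤ brickHalfSpaceCount n * triSawCount M := by
  classical
  rw [brickHalfSpaceCount, brickHalfSpaceCount, ← card_brickSaws M, ← Finset.card_product]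
  refine Finset.card_le_card_of_injOn (fun ω => (prefixWalk n ω, suffixWalk n M ω)) ?_ (cut_injOn n M)
  intro ω hω
  rw [Finset.mem_coe] at hω
  rw [Finset.mem_coe, Finset.mem_product]
  exact ⟨prefixWalk_mem hω, suffixWalk_mem (mem_brickHalfSpaceWalks.1 hω).1⟩

end Literature.Probability.RandomPlanarGeometry.SAW
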